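import Literature.AlgebraicGeometry.Motives.HodgeStructureCorrespondenceTranspose
import Literature.AlgebraicGeometry.Motives.HodgeStructureDivisorClassesFunctoriality
import HarnessLib

/-!
# The transpose of a Lefschetz correspondence is Lefschetz: `ᵗ ℚ[B¹(H₁ ⊕ H₂)] = ℚ[B¹(H₂ ⊕ H₁)]`, `ᵗ D^k(H₁ ⊕ H₂) = D^k(H₂ ⊕ H₁)`

[topic AlgebraicGeometry/Motives]

Layer `Literature/AlgebraicGeometry/Motives`, lane `lit-hodgefound` (Track 2 foundations library; prover seat `lit-hodgefound-p34`,
generation 32, row g32-#9). THEOREMS ONLY (no `def`, no named fact, no instance, no notation; net debt `0`). Sequel of row g32-#8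
(`ᵗu := ⋀(s) u`, `s = LinearEquiv.prodComm`; Lange §6.2.2 "`ᵗZ := s^*Z`") and of the gen-26 functoriality file
`Motives/HodgeStructureDivisorClassesFunctoriality` ("`φ^*` maps Lefschetz classes to Lefschetz classes": `Hom.map_adjoin_hodgeClasses_two_le`,
`Hom.exteriorPower_map_mem_divisorClasses`).

The exchange `s : V₁ ⊕ V₂ ⥲ V₂ ⊕ V₁` underlies the isomorphism of Hodge structures `(pr₂, pr₁) : H₁ ⊕ H₂ ⥲ H₂ ⊕ H₁` (the tree's
`Hom.prodLift (Hom.prodSnd H₁ H₂) (Hom.prodFst H₁ H₂)`), so `ᵗ = ⋀(s) = (pr₂, pr₁)^*` on `H•(A × B) = ⋀(V₁ ⊕ V₂)` is a pull-back by a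
morphism of Hodge structures and preserves Lefschetz classes, degree by degree. No polarization is needed.

## Sources, VERBATIM

J. S. Milne, *Lefschetz classes on abelian varieties*, Duke Math. J. **96** (1999) [Milne1999LefschetzClasses], §5 p. 662 L14–L19:
"A regular map `φ : X → Y` of smooth projective varieties induces a homomorphism `φ^* : H^*(Y) → H^*(X)` of graded `k`-algebras […].
Because `φ^*` is a homomorphism of graded `k`-algebras commuting with the cycle maps, it maps Lefschetz classes to Lefschetz classes."
H. Lange, *Abelian Varieties over the Complex Numbers* (2023) [Lange2023AbelianVarietiesComplex], §6.2.2 (p. 304): "Let `s := X₁ × X₂ →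
X₂ × X₁` be the exchange morphism […] `Z ↦ ᵗZ := s^*Z`."

## What is PROVED

* `Hom.prodLift_prodSnd_prodFst_toLinearMap`: the linear map of `(pr₂, pr₁) : H₁ ⊕ H₂ → H₂ ⊕ H₁` is `s = prodComm`.
* `map_prodComm_prodComm` (`ᵗᵗu = u`).
* **`map_prodComm_mem_adjoin_hodgeClasses_two`** (`u ∈ ℚ[B¹(H₁ ⊕ H₂)] ⟹ ᵗu ∈ ℚ[B¹(H₂ ⊕ H₁)]`) and **`…_iff`**.
* **`map_prodComm_mem_map_divisorClasses`** (`u ∈ D^k(H₁ ⊕ H₂) ⟹ ᵗu ∈ D^k(H₂ ⊕ H₁)`) and **`…_iff`**.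

TWIN NOTICE (RULING 29 bis): no torus-forms twin imported or restated.

## References

* [Milne1999LefschetzClasses] J. S. Milne, *Lefschetz classes on abelian varieties*, Duke Math. J. 96 (1999), §5 p. 662.
* [Lange2023AbelianVarietiesComplex] H. Lange, *Abelian Varieties over the Complex Numbers* (2023), §6.2.2 (p. 304).
* [DeligneHodgeII1971] P. Deligne, *Théorie de Hodge II* (1971), 2.1 (morphisms of Hodge structures; products).
-/

noncomputable section

open scoped TensorProduct

namespace Literature.AlgebraicGeometry.Motives

universe u

namespace HodgeStructure

open ExteriorLefschetz ExteriorAlgebra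

variable {V₁ V₂ : Type u} [AddCommGroup V₁] [Module ℚ V₁] [AddCommGroup V₂] [Module ℚ V₂] {n : ℤ}
  {H₁ : HodgeStructure V₁ n} {H₂ : HodgeStructure V₂ n}

/-- **The exchange `s : V₁ ⊕ V₂ ⥲ V₂ ⊕ V₁` is the linear map of the morphism of Hodge structures `(pr₂, pr₁) : H₁ ⊕ H₂ → H₂ ⊕ H₁`.**
[cite: DeligneHodgeII1971, 2.1] [cite: Lange2023AbelianVarietiesComplex, §6.2.2 (p. 304, "the exchange morphism s")] -/
theorem Hom.prodLift_prodSnd_prodFst_toLinearMap (H₁ : HodgeStructure V₁ n) (H₂ : HodgeStructure V₂ n) :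
    (Hom.prodLift (Hom.prodSnd H₁ H₂) (Hom.prodFst H₁ H₂)).toLinearMap =
      (LinearEquiv.prodComm ℚ V₁ V₂ : (V₁ × V₂) →ₗ[ℚ] (V₂ × V₁)) :=
  LinearMap.ext fun _ ↦ rfl

/-- **`ᵗᵗu = u`** (`s' ∘ s = id`). [cite: Lange2023AbelianVarietiesComplex, §6.2.2 (p. 304)] -/
theorem map_prodComm_prodComm (u : ExteriorAlgebra ℚ (V₁ × V₂)) :
    ExteriorAlgebra.map (LinearEquiv.prodComm ℚ V₂ V₁ : (V₂ × V₁) →ₗ[ℚ] (V₁ × V₂))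
        (ExteriorAlgebra.map (LinearEquiv.prodComm ℚ V₁ V₂ : (V₁ × V₂) →ₗ[ℚ] (V₂ × V₁)) u) = u := by
  rw [← LinearEquiv.symm_prodComm]
  exact map_equiv_symm_apply' (LinearEquiv.prodComm ℚ V₁ V₂) u

/-- **THE TRANSPOSE OF A LEFSCHETZ CORRESPONDENCE IS LEFSCHETZ: `u ∈ ℚ[B¹(H₁ ⊕ H₂)] ⟹ ᵗu ∈ ℚ[B¹(H₂ ⊕ H₁)]`** — `ᵗ = ⋀(s) = (pr₂, pr₁)^*`
is the pull-back by a morphism of Hodge structures, and "`φ^*` […] maps Lefschetz classes to Lefschetz classes" (the tree's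
`Hom.map_adjoin_hodgeClasses_two_le`). [cite: Milne1999LefschetzClasses, §5 p. 662 L14–L19] [cite: Lange2023AbelianVarietiesComplex, §6.2.2 (p. 304)] -/
theorem map_prodComm_mem_adjoin_hodgeClasses_two {u : ExteriorAlgebra ℚ (V₁ × V₂)}
    (hu : u ∈ Algebra.adjoin ℚ ((((H₁.prod H₂).exteriorPower 2).hodgeClasses n).map (⋀[ℚ]^2 (V₁ × V₂)).subtype :
      Set (ExteriorAlgebra ℚ (V₁ × V₂)))) :
    ExteriorAlgebra.map (LinearEquiv.prodComm ℚ V₁ V₂ : (V₁ × V₂) →ₗ[ℚ] (V₂ × V₁)) u ∈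
      Algebra.adjoin ℚ ((((H₂.prod H₁).exteriorPower 2).hodgeClasses n).map (⋀[ℚ]^2 (V₂ × V₁)).subtype :
        Set (ExteriorAlgebra ℚ (V₂ × V₁))) := by
  rw [← Hom.prodLift_prodSnd_prodFst_toLinearMap H₁ H₂]
  exact (Hom.prodLift (Hom.prodSnd H₁ H₂) (Hom.prodFst H₁ H₂)).map_adjoin_hodgeClasses_two_le ⟨u, hu, rfl⟩

/-- **`u ∈ ℚ[B¹(H₁ ⊕ H₂)] ⟺ ᵗu ∈ ℚ[B¹(H₂ ⊕ H₁)]`** (`ᵗᵗu = u`). [cite: Milne1999LefschetzClasses, §5 p. 662 L14–L19] [cite: Lange2023AbelianVarietiesComplex, §6.2.2 (p. 304)] -/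
theorem map_prodComm_mem_adjoin_hodgeClasses_two_iff (u : ExteriorAlgebra ℚ (V₁ × V₂)) :
    ExteriorAlgebra.map (LinearEquiv.prodComm ℚ V₁ V₂ : (V₁ × V₂) →ₗ[ℚ] (V₂ × V₁)) u ∈
        Algebra.adjoin ℚ ((((H₂.prod H₁).exteriorPower 2).hodgeClasses n).map (⋀[ℚ]^2 (V₂ × V₁)).subtype :
          Set (ExteriorAlgebra ℚ (V₂ × V₁))) ↔
      u ∈ Algebra.adjoin ℚ ((((H₁.prod H₂).exteriorPower 2).hodgeClasses n).map (⋀[ℚ]^2 (V₁ × V₂)).subtype :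
        Set (ExteriorAlgebra ℚ (V₁ × V₂))) := by
  refine ⟨fun h ↦ ?_, map_prodComm_mem_adjoin_hodgeClasses_two⟩
  rw [← map_prodComm_prodComm u]
  exact map_prodComm_mem_adjoin_hodgeClasses_two h

/-- **GRADED FORM: `u ∈ D^k(H₁ ⊕ H₂) ⟹ ᵗu ∈ D^k(H₂ ⊕ H₁)`** (`⋀^{2k}(pr₂, pr₁)` maps `D^k` to `D^k`, the tree's
`Hom.exteriorPower_map_mem_divisorClasses`). [cite: Milne1999LefschetzClasses, §5 p. 662 L14–L19] [cite: Lange2023AbelianVarietiesComplex, §6.2.2 (p. 304)] -/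
theorem map_prodComm_mem_map_divisorClasses {k : ℕ} {u : ExteriorAlgebra ℚ (V₁ × V₂)}
    (hu : u ∈ ((H₁.prod H₂).divisorClasses k).map (⋀[ℚ]^(2 * k) (V₁ × V₂)).subtype) :
    ExteriorAlgebra.map (LinearEquiv.prodComm ℚ V₁ V₂ : (V₁ × V₂) →ₗ[ℚ] (V₂ × V₁)) u ∈
      ((H₂.prod H₁).divisorClasses k).map (⋀[ℚ]^(2 * k) (V₂ × V₁)).subtype := by
  obtain ⟨u, hu, rfl⟩ := hu
  refine ⟨_root_.exteriorPower.map (2 * k) (Hom.prodLift (Hom.prodSnd H₁ H₂) (Hom.prodFst H₁ H₂)).toLinearMap u,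
    (Hom.prodLift (Hom.prodSnd H₁ H₂) (Hom.prodFst H₁ H₂)).exteriorPower_map_mem_divisorClasses hu, ?_⟩
  rw [Submodule.subtype_apply, Submodule.subtype_apply, coe_exteriorPower_map, Hom.prodLift_prodSnd_prodFst_toLinearMap]

/-- **`u ∈ D^k(H₁ ⊕ H₂) ⟺ ᵗu ∈ D^k(H₂ ⊕ H₁)`.** [cite: Milne1999LefschetzClasses, §5 p. 662 L14–L19] [cite: Lange2023AbelianVarietiesComplex, §6.2.2 (p. 304)] -/
theorem map_prodComm_mem_map_divisorClasses_iff {k : ℕ} (u : ExteriorAlgebra ℚ (V₁ × V₂)) :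
    ExteriorAlgebra.map (LinearEquiv.prodComm ℚ V₁ V₂ : (V₁ × V₂) →ₗ[ℚ] (V₂ × V₁)) u ∈
        ((H₂.prod H₁).divisorClasses k).map (⋀[ℚ]^(2 * k) (V₂ × V₁)).subtype ↔
      u ∈ ((H₁.prod H₂).divisorClasses k).map (⋀[ℚ]^(2 * k) (V₁ × V₂)).subtype := by
  refine ⟨fun h ↦ ?_, map_prodComm_mem_map_divisorClasses⟩
  rw [← map_prodComm_prodComm u]
  exact map_prodComm_mem_map_divisorClasses h

end HodgeStructure

end Literature.AlgebraicGeometry.Motives
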